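import Summits.PneNP.PneNP.Theses.HeisenbergSparsestCut

/-!
# Route HeisenbergSparsestCut — `HeisenbergGivesLasserreGaps` (stmt-PneNP-2291)

Glue: `HeisenbergBoxesAreLasserreMetrics → (CKN, inlined box form) → LasserreCutMetricsFarFromL1`.
Given a degree `d` and a distortion `D`, take `K = K(d)` from the engine, choose `n ≥ 2` with
`c (log n)^c > max (D K) 0`, and move the degree-`d` pseudoexpectation on the box `B_n` to the variables
`0, …, m-1` (`m = |B_n|`) along `MvPolynomial.rename` (degree does not increase, so positivity and the
Booleanity identities transport). A `D`-embedding of the resulting pseudo-cut-metric into `ℓ₁^N` would be a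
`max (D K) 0`-bi-Lipschitz embedding of `s·d_W` on `B_n`, contradicting CKN at this `n`.
-/

set_option linter.dupNamespace false -- `Summit.PneNP.PneNP.…`: summit = sub-problem name (D-0017 single-conjunct layout)

namespace Summit.PneNP.PneNP.Theorems

open Filter MvPolynomial Literature.Computability.MetaComplexity

/-- Transport of a degree-`d` pseudoexpectation along a renaming of the variables: `E ∘ rename τ` is again a
degree-`d` pseudoexpectation (renaming does not increase total degree). [cite: arXiv170104521, Def. 2.7] -/
theorem heisenbergGivesLasserreGaps_isPseudoexpectation_rename {d : ℕ} {E : MvPolynomial ℕ ℝ →ₗ[ℝ] ℝ}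
    (hE : IsPseudoexpectation d E) (τ : ℕ → ℕ) :
    IsPseudoexpectation d
      (E ∘ₗ (MvPolynomial.rename τ : MvPolynomial ℕ ℝ →ₐ[ℝ] MvPolynomial ℕ ℝ).toLinearMap) := by
  refine ⟨?_, fun p hp => ?_⟩
  · simp only [LinearMap.coe_comp, Function.comp_apply, AlgHom.toLinearMap_apply, map_one]
    exact hE.1
  · simp only [LinearMap.coe_comp, Function.comp_apply, AlgHom.toLinearMap_apply, map_mul]
    exact hE.2 _ ((Nat.mul_le_mul_left 2 (totalDegree_rename_le τ p)).trans hp)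

/-- Transport of the Booleanity identities along a renaming: if `E` satisfies `x_i² = x_i` in degree `d` for
every `i`, so does `E ∘ rename τ`. [cite: arXiv170104521, Def. 2.8] -/
theorem heisenbergGivesLasserreGaps_satisfiesIdentity_rename {d : ℕ} {E : MvPolynomial ℕ ℝ →ₗ[ℝ] ℝ}
    (hE : ∀ i : ℕ, SatisfiesIdentity d E (boolAxiom i)) (τ : ℕ → ℕ) (i : ℕ) :
    SatisfiesIdentity d
      (E ∘ₗ (MvPolynomial.rename τ : MvPolynomial ℕ ℝ →ₐ[ℝ] MvPolynomial ℕ ℝ).toLinearMap)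
      (boolAxiom i) := by
  intro r hr
  simp only [LinearMap.coe_comp, Function.comp_apply, AlgHom.toLinearMap_apply, map_mul]
  have hren : rename τ (boolAxiom i) = boolAxiom (τ i) := by
    simp only [boolAxiom, map_sub, map_pow, rename_X]
  rw [hren]
  refine hE (τ i) _ (le_trans (Nat.add_le_add ?_ (totalDegree_rename_le τ r)) hr)
  rw [← hren]
  exact totalDegree_rename_le τ _

/-- **stmt-PneNP-2291** `HeisenbergGivesLasserreGaps`: the engine (Heisenberg boxes carry degree-`d`
pseudo-cut-metrics `K(d)`-bi-Lipschitz to `s·d_W`) and the Cheeger–Kleiner–Naor distortion bound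
(`c₁(B_n, d_W) ≥ c (log n)^c`, inlined) give degree-`d` pseudo-cut-metrics on `{0,…,m-1}` with no
`D`-bi-Lipschitz embedding into any `ℓ₁^N`, for every `d` and `D`. [cite: CheegerKleinerNaor2011, Thm 1.1] -/
theorem heisenbergSparsestCut_heisenbergGivesLasserreGaps_proof :
    Summit.PneNP.PneNP.Theses.HeisenbergSparsestCut.HeisenbergGivesLasserreGaps := by
  unfold Summit.PneNP.PneNP.Theses.HeisenbergSparsestCut.HeisenbergGivesLasserreGaps
    Summit.PneNP.PneNP.Theses.HeisenbergSparsestCut.HeisenbergBoxesAreLasserreMetrics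
    Summit.PneNP.PneNP.Theses.HeisenbergSparsestCut.LasserreCutMetricsFarFromL1
  intro hBox hCKN d D
  obtain ⟨c, hc, hCKN⟩ := hCKN
  obtain ⟨K, hK⟩ := hBox d
  -- a scale `n ≥ 2` at which the CKN bound beats `max (D K) 0`
  obtain ⟨n, hn2, hn⟩ : ∃ n : ℕ, 2 ≤ n ∧ max (D * K) 0 < c * Real.log n ^ c := by
    have ht : Tendsto (fun n : ℕ => c * Real.log n ^ c) atTop atTop :=
      Tendsto.const_mul_atTop hc
        ((tendsto_rpow_atTop hc).comp (Real.tendsto_log_atTop.comp tendsto_natCast_atTop_atTop))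
    obtain ⟨n, hn⟩ := ((eventually_ge_atTop 2).and (ht.eventually_gt_atTop (max (D * K) 0))).exists
    exact ⟨n, hn.1, hn.2⟩
  obtain ⟨v, E, s, -, hs, hPE, hBool, hLip⟩ := hK n
  -- the box `B_n` as a finset, enumerated by `Fin m`
  set B : Finset (ℤ × ℤ × ℤ) :=
    Finset.Icc (-(n : ℤ)) n ×ˢ (Finset.Icc (-(n : ℤ)) n ×ˢ Finset.Icc (-((n : ℤ) ^ 2)) ((n : ℤ) ^ 2))
    with hB
  have hmemB : ∀ g : ℤ × ℤ × ℤ, g ∈ B ↔ |g.1| ≤ n ∧ |g.2.1| ≤ n ∧ |g.2.2| ≤ (n : ℤ) ^ 2 := by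
    intro g
    simp only [hB, Finset.mem_product, Finset.mem_Icc, abs_le]
  set m : ℕ := B.card with hm
  let e : B ≃ Fin m := B.equivFin
  let τ : ℕ → ℕ := fun i => if h : i < m then v ((e.symm ⟨i, h⟩ : B) : ℤ × ℤ × ℤ) else 0
  have hτ : ∀ (g : ℤ × ℤ × ℤ) (hg : g ∈ B), τ (e ⟨g, hg⟩) = v g := by
    intro g hg
    simp only [τ, dif_pos (Fin.isLt _), Fin.eta, Equiv.symm_apply_apply]
  set E' : MvPolynomial ℕ ℝ →ₗ[ℝ] ℝ :=
    E ∘ₗ (MvPolynomial.rename τ : MvPolynomial ℕ ℝ →ₐ[ℝ] MvPolynomial ℕ ℝ).toLinearMap with hE'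
  have hE'X : ∀ i j : ℕ, E' ((X i - X j) ^ 2) = E ((X (τ i) - X (τ j)) ^ 2) := by
    intro i j
    simp only [hE', LinearMap.coe_comp, Function.comp_apply, AlgHom.toLinearMap_apply, map_pow,
      map_sub, rename_X]
  refine ⟨m, E', heisenbergGivesLasserreGaps_isPseudoexpectation_rename hPE τ,
    heisenbergGivesLasserreGaps_satisfiesIdentity_rename hBool τ, ?_⟩
  rintro ⟨N, f, hf⟩
  -- pull the putative embedding back to the box
  let F : ℤ × ℤ × ℤ → Fin N → ℝ := fun g => if hg : g ∈ B then f (e ⟨g, hg⟩) else 0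
  have hFB : ∀ (g : ℤ × ℤ × ℤ) (hg : g ∈ B), F g = f (e ⟨g, hg⟩) := fun g hg => dif_pos hg
  refine absurd (hCKN n hn2 N F s (max (D * K) 0) hs fun g h g1 g2 g3 h1 h2 h3 => ?_) (not_le.mpr hn)
  have hg : g ∈ B := (hmemB g).2 ⟨g1, g2, by exact_mod_cast g3⟩
  have hh : h ∈ B := (hmemB h).2 ⟨h1, h2, by exact_mod_cast h3⟩
  obtain ⟨hlo, hhi⟩ := hLip g h g1 g2 g3 h1 h2 h3
  obtain ⟨hf1, hf2⟩ := hf (e ⟨g, hg⟩) (e ⟨h, hh⟩)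
  rw [hE'X, hτ g hg, hτ h hh] at hf1 hf2
  rw [hFB g hg, hFB h hh]
  refine ⟨hlo.trans hf1, hf2.trans ?_⟩
  -- `D · ρ(g,h) ≤ max (D K) 0 · s · d_W(g,h)`
  set ρ : ℝ := E ((X (v g) - X (v h)) ^ 2) with hρ
  set δ : ℝ := ((SimpleGraph.fromRel fun a b : ℤ × ℤ × ℤ =>
      b = (a.1 + 1, a.2.1, a.2.2) ∨ b = (a.1, a.2.1 + 1, a.2.2 + a.1)).dist g h : ℝ) with hδ
  have hδ0 : 0 ≤ δ := Nat.cast_nonneg _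
  have hsδ : 0 ≤ s * δ := mul_nonneg hs.le hδ0
  have hρ0 : 0 ≤ ρ := hsδ.trans hlo
  have hmax0 : 0 ≤ max (D * K) 0 := le_max_right _ _
  rcases le_or_gt 0 D with hD | hD
  · calc D * ρ ≤ D * (K * s * δ) := mul_le_mul_of_nonneg_left hhi hD
      _ = (D * K) * (s * δ) := by ring
      _ ≤ max (D * K) 0 * (s * δ) := mul_le_mul_of_nonneg_right (le_max_left _ _) hsδ
      _ = max (D * K) 0 * s * δ := by ring
  · calc D * ρ ≤ 0 := mul_nonpos_of_nonpos_of_nonneg hD.le hρ0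
      _ ≤ max (D * K) 0 * (s * δ) := mul_nonneg hmax0 hsδ
      _ = max (D * K) 0 * s * δ := by ring

end Summit.PneNP.PneNP.Theorems
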